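import Summits.QuantumFields.YangMills.Theorems.AtomicCalibrationRWhitneyBookkeeping
import Summits.QuantumFields.YangMills.Theorems.AtomicCalibrationRFlatLeibniz

/-!
# AtomicCalibrationR (stmt-QuantumFields-28169), E2 `stub_offDiagonalWhitney` — clause (v) for the far pieces of construction (T)
# (construction (T) of the E2 helper note, evidence #19 on 28169; prover w4 g22, free hands)

Companion of `AtomicCalibrationRBandPiece`: the far pieces `P = G · b` (`b = pairCut 0 · gridBump`, or any `C^∞` bump with a
rate `‖D^i b(z)‖ ≤ R^i`, `i ≤ m`) need no flatness, only the Schwartz decay of `F` at the point: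

* `norm_iteratedFDeriv_le_schwartzNorm_div_mono` — `‖D^j F(z)‖ ≤ 2^M schwartzNorm M F/(1+‖z‖)^{k'}` for all `j ≤ m`,
  `M = max k' m` (one constant for all orders `≤ m`);
* `norm_iteratedFDeriv_farPiece_le` — `‖D^m (G b)(z)‖ ≤ (2^M ‖F‖_M/(1+‖z‖)^{k'}) (1 + R)^m` for `G` dominated order-by-order
  by `F` (e.g. `Re F`, `Im F`).

No stub/crux/rung/summit is closed; nothing here touches Yang–Mills; the YM mass gap is NOT proved. [folklore]
-/

set_option autoImplicit false

noncomputable section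

open scoped BigOperators ContDiff
open Set
open Summit.QuantumFields.YangMills.Cruxes.AtomicCalibrationR.FlatLeibniz (norm_iteratedFDeriv_mul_le_of_flat)
open Summit.QuantumFields.YangMills.Cruxes.AtomicCalibrationR.WhitneyBookkeeping (norm_iteratedFDeriv_le_schwartzNorm_div)
open Literature.MathematicalPhysics.QuantumLattice (schwartzNorm schwartzNorm_nonneg schwartzNorm_mono)

namespace Summit.QuantumFields.YangMills.Cruxes.AtomicCalibrationR.FarPiece

variable {X : Type*} [NormedAddCommGroup X] [NormedSpace ℝ X]

/-- One decay constant for all orders `j ≤ m`: `‖D^j F(z)‖ ≤ 2^M schwartzNorm M F/(1+‖z‖)^{k'}`, `M = max k' m`. -/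
theorem norm_iteratedFDeriv_le_schwartzNorm_div_mono (F : SchwartzMap X ℂ) (k' m : ℕ) {j : ℕ} (hj : j ≤ m) (z : X) :
    ‖iteratedFDeriv ℝ j F z‖ ≤ 2 ^ max k' m * schwartzNorm (max k' m) F / (1 + ‖z‖) ^ k' := by
  refine (norm_iteratedFDeriv_le_schwartzNorm_div F k' j z).trans ?_
  have hle : max k' j ≤ max k' m := max_le_max le_rfl hj
  have h2 : (2 : ℝ) ^ max k' j ≤ 2 ^ max k' m := pow_le_pow_right₀ (by norm_num) hle
  have hS := schwartzNorm_mono hle F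
  have hS0 : 0 ≤ schwartzNorm (max k' j) F := schwartzNorm_nonneg _ _
  exact div_le_div_of_nonneg_right (mul_le_mul h2 hS hS0 (by positivity)) (by positivity)

/-- **Clause (v) for far pieces.**  `G` real `C^∞` with `‖D^j G‖ ≤ ‖D^j F‖` pointwise, `b` a `C^∞` bump with
`‖D^i b(z)‖ ≤ R^i` (`i ≤ m`): `‖D^m (G b)(z)‖ ≤ (2^M ‖F‖_M/(1+‖z‖)^{k'}) (1+R)^m`, `M = max k' m`. [folklore] -/
theorem norm_iteratedFDeriv_farPiece_le (F : SchwartzMap X ℂ) {G : X → ℝ} (hG : ContDiff ℝ ∞ G)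
    (hGF : ∀ (j : ℕ) (w : X), ‖iteratedFDeriv ℝ j G w‖ ≤ ‖iteratedFDeriv ℝ j F w‖) {b : X → ℝ} (hb : ContDiff ℝ ∞ b)
    (k' m : ℕ) {R : ℝ} (z : X) (hbR : ∀ i : ℕ, i ≤ m → ‖iteratedFDeriv ℝ i b z‖ ≤ R ^ i) :
    ‖iteratedFDeriv ℝ m (fun w => G w * b w) z‖ ≤
      (2 ^ max k' m * schwartzNorm (max k' m) F / (1 + ‖z‖) ^ k') * (1 + R) ^ m := by
  set P : ℝ := 2 ^ max k' m * schwartzNorm (max k' m) F / (1 + ‖z‖) ^ k' with hP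
  have hP0 : 0 ≤ P := by have := schwartzNorm_nonneg (max k' m) F; positivity
  have hFb : ∀ j : ℕ, j ≤ m → ‖iteratedFDeriv ℝ j G z‖ ≤ P * (1 : ℝ) ^ (m - j) := by
    intro j hj
    rw [one_pow, mul_one]
    exact (hGF j z).trans (norm_iteratedFDeriv_le_schwartzNorm_div_mono F k' m hj z)
  have hΦb : ∀ i : ℕ, i ≤ m → ‖iteratedFDeriv ℝ i b z‖ ≤ 1 * R⁻¹⁻¹ ^ i := by
    intro i hi; rw [inv_inv, one_mul]; exact hbR i hi
  have h := norm_iteratedFDeriv_mul_le_of_flat (A := ℝ) hG hb le_rfl hP0 zero_le_one z hFb hΦb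
  refine h.trans (le_of_eq ?_)
  rw [Nat.sub_self, pow_zero, mul_one, mul_one, one_div, inv_inv]

end Summit.QuantumFields.YangMills.Cruxes.AtomicCalibrationR.FarPiece

end
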